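import Literature.Probability.LatticeModels.LikelihoodRatioOrderClosure

/-!
# A density-free four functions theorem for four measures on `ℝ^ι`: the box inequality implies the set inequality

Support file of the Sahi cell (`prim-sahi`, typer seat, generation 18; `--supports stmt-CriticalPhenomena-4575`).
Theorems only (no definitions, no named facts, no sorries).

Ahlswede–Daykin's four functions theorem (Mathlib `four_functions_theorem`) says: on a finite distributive lattice,
`f₀(a)f₁(b) ≤ f₂(a ∧ b)f₃(a ∨ b)` for all points implies `f₀(S)f₁(T) ≤ f₂(S ∧ T)f₃(S ∨ T)` for all subsets.  Its
measure-theoretic, DENSITY-FREE form on `ℝ^ι` (`ι` finite) is proved here: for four finite Borel measures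
`μ₀, μ₁, μ₂, μ₃`,

  `μ₀[a,b] μ₁[a',b'] ≤ μ₂[a ∧ a', b ∧ b'] μ₃[a ∨ a', b ∨ b']` for all closed boxes
  ⟹ `μ₀(A) μ₁(B) ≤ μ₂(A ∧ B) μ₃(A ∨ B)` for all Borel `A, B`

(`A ∧ B = A ⊼ B = {a ⊓ b}`, `A ∨ B = A ⊻ B`; non-measurable images read with outer measure): `quad_icoBox`
(half-open boxes by continuity from below), `quad_fibre` (dyadic cell masses satisfy the four-functions hypothesis),
`quad_preimage_finset` (finite unions of cells of one grid: Ahlswede–Daykin with the four cell-mass functions),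
`quad_isCompact` (compact sets: discretise, thicken, `n → ∞`), `quad_measurableSet` (inner regularity).

The diagonal `μ₀ = μ₁ = μ₂ = μ₃` is Colangelo–Müller–Scarsini's Theorem 1 (corrected box form ⟺ Definition 2; tree
`MTP2WeakClosure.mIsSetTP2_iff_cmsCondC'`), the pair `(μ, ν, μ, ν)` is the tp₂ order (tree
`LikelihoodRatioOrderClosure.mTP2Le_iff_mBoxTP2Le`), whose dyadic discretisation device (`discretize`, `icoBox`,
`shrink`, thickening lemmas) is reused verbatim.  The genuinely four-measure case is what Fuchs–Wang's density-free
conditional MTP₂ (5.1) needs: for a law `μ` of `(X_A, X_B)` and `x, y ∈ ℝ^B` the four measures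
`C ↦ μ(C × (−∞,z])`, `z ∈ {x, y, x ∧ y, x ∨ y}` (companion file `SahiCMTP2BoxCriterion.lean`).

No sorries, no new axioms.  References: Ahlswede–Daykin 1978 (Mathlib); [ColangeloMullerScarsini2006] Thm. 1;
[KarlinRinott1980] Thm. 2.1 (product reference measure); the density-free four-measure statement is this work.
-/

noncomputable section

namespace Summit.CriticalPhenomena.PercolationContinuityZ3.Theorems.SahiCMTP2

open MeasureTheory Set Filter Topology Function Metric
open Literature.Probability.LatticeModels.Affiliation
open scoped ENNReal SetFamily

variable {ι : Type*}

/-! ### Half-open boxes and dyadic cells -/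

section Cells

/-- Adding a constant vector commutes with `⊓`. [folklore] -/
private theorem add_const_inf₄ (q q' : ι → ℝ) (c : ℝ) :
    (fun i => q i + c) ⊓ (fun i => q' i + c) = fun i => (q ⊓ q') i + c :=
  funext fun i => min_add_add_right (q i) (q' i) c

/-- Adding a constant vector commutes with `⊔`. [folklore] -/
private theorem add_const_sup₄ (q q' : ι → ℝ) (c : ℝ) :
    (fun i => q i + c) ⊔ (fun i => q' i + c) = fun i => (q ⊔ q') i + c :=
  funext fun i => max_add_add_right (q i) (q' i) c

variable [Fintype ι]

open scoped FinsetFamily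

/-- **Closed boxes ⇒ half-open boxes, four measures**: if `μ₀[a,b] μ₁[a',b'] ≤ μ₂[a ∧ a', b ∧ b'] μ₃[a ∨ a', b ∨ b']` for
all closed boxes, the same holds for the half-open boxes `[a,b)` (continuity from below along `[a, b − 1/(j+1)]`).
[this work] -/
theorem quad_icoBox (μ₀ μ₁ μ₂ μ₃ : Measure (ι → ℝ)) [IsFiniteMeasure μ₀] [IsFiniteMeasure μ₁]
    (h : ∀ a b a' b' : ι → ℝ,
      μ₀ (Icc a b) * μ₁ (Icc a' b') ≤ μ₂ (Icc (a ⊓ a') (b ⊓ b')) * μ₃ (Icc (a ⊔ a') (b ⊔ b')))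
    (a b a' b' : ι → ℝ) :
    μ₀ (icoBox a b) * μ₁ (icoBox a' b') ≤ μ₂ (icoBox (a ⊓ a') (b ⊓ b')) * μ₃ (icoBox (a ⊔ a') (b ⊔ b')) := by
  have hmono : ∀ c b : ι → ℝ, Monotone fun j => Icc c (shrink b j) :=
    fun c b j k hjk => Icc_subset_Icc le_rfl (shrink_mono b hjk)
  have hlim : ∀ (ρ : Measure (ι → ℝ)) (c b : ι → ℝ),
      Tendsto (fun j => ρ (Icc c (shrink b j))) atTop (𝓝 (ρ (icoBox c b))) := by
    intro ρ c b
    rw [icoBox_eq_iUnion_Icc]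
    exact tendsto_measure_iUnion_atTop (hmono c b)
  have hprod : Tendsto (fun j => μ₀ (Icc a (shrink b j)) * μ₁ (Icc a' (shrink b' j))) atTop
      (𝓝 (μ₀ (icoBox a b) * μ₁ (icoBox a' b'))) :=
    ENNReal.Tendsto.mul (hlim μ₀ a b) (Or.inr (measure_ne_top _ _)) (hlim μ₁ a' b')
      (Or.inr (measure_ne_top _ _))
  refine le_of_tendsto' hprod fun j => ?_
  have h1 := h a (shrink b j) a' (shrink b' j)
  rw [shrink_inf, shrink_sup] at h1
  exact h1.trans (mul_le_mul' (measure_mono (Icc_shrink_subset_icoBox _ _ _))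
    (measure_mono (Icc_shrink_subset_icoBox _ _ _)))

/-- **Dyadic cell masses of the four measures satisfy the four-functions hypothesis**:
`μ₀(φ⁻¹q) μ₁(φ⁻¹q') ≤ μ₂(φ⁻¹(q ∧ q')) μ₃(φ⁻¹(q ∨ q'))`, `φ = discretize n`. [this work] -/
theorem quad_fibre (μ₀ μ₁ μ₂ μ₃ : Measure (ι → ℝ)) [IsFiniteMeasure μ₀] [IsFiniteMeasure μ₁]
    (h : ∀ a b a' b' : ι → ℝ,
      μ₀ (Icc a b) * μ₁ (Icc a' b') ≤ μ₂ (Icc (a ⊓ a') (b ⊓ b')) * μ₃ (Icc (a ⊔ a') (b ⊔ b')))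
    (n : ℕ) (q q' : ι → ℝ) :
    μ₀ (discretize n ⁻¹' {q}) * μ₁ (discretize n ⁻¹' {q'}) ≤
      μ₂ (discretize n ⁻¹' {q ⊓ q'}) * μ₃ (discretize n ⁻¹' {q ⊔ q'}) := by
  by_cases hq : discretize n q = q
  · by_cases hq' : discretize n q' = q'
    · have hm : discretize n (q ⊓ q') = q ⊓ q' := by rw [discretize_inf, hq, hq']
      have hj : discretize n (q ⊔ q') = q ⊔ q' := by rw [discretize_sup, hq, hq']
      rw [preimage_discretize_singleton hq, preimage_discretize_singleton hq',
        preimage_discretize_singleton hm, preimage_discretize_singleton hj, ← add_const_inf₄,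
        ← add_const_sup₄]
      exact quad_icoBox μ₀ μ₁ μ₂ μ₃ h _ _ _ _
    · rw [preimage_discretize_singleton_eq_empty hq']; simp
  · rw [preimage_discretize_singleton_eq_empty hq]; simp

/-- **The four-measure inequality for finite unions of cells of one dyadic grid**: for finite sets of lattice points
`S, T`, `μ₀(φ⁻¹S) μ₁(φ⁻¹T) ≤ μ₂(φ⁻¹(S ∧ T)) μ₃(φ⁻¹(S ∨ T))` — Ahlswede–Daykin on the lattice `ℝ^ι` with the four
cell-mass functions. [this work] -/
theorem quad_preimage_finset [DecidableEq (ι → ℝ)] (μ₀ μ₁ μ₂ μ₃ : Measure (ι → ℝ)) [IsFiniteMeasure μ₀]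
    [IsFiniteMeasure μ₁] [IsFiniteMeasure μ₂] [IsFiniteMeasure μ₃]
    (h : ∀ a b a' b' : ι → ℝ,
      μ₀ (Icc a b) * μ₁ (Icc a' b') ≤ μ₂ (Icc (a ⊓ a') (b ⊓ b')) * μ₃ (Icc (a ⊔ a') (b ⊔ b')))
    (n : ℕ) (S T : Finset (ι → ℝ)) :
    μ₀ (discretize n ⁻¹' ↑S) * μ₁ (discretize n ⁻¹' ↑T) ≤
      μ₂ (discretize n ⁻¹' ↑(S ⊼ T)) * μ₃ (discretize n ⁻¹' ↑(S ⊻ T)) := by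
  set f₀ : (ι → ℝ) → ℝ := fun q => μ₀.real (discretize n ⁻¹' {q}) with hf₀
  set f₁ : (ι → ℝ) → ℝ := fun q => μ₁.real (discretize n ⁻¹' {q}) with hf₁
  set f₂ : (ι → ℝ) → ℝ := fun q => μ₂.real (discretize n ⁻¹' {q}) with hf₂
  set f₃ : (ι → ℝ) → ℝ := fun q => μ₃.real (discretize n ⁻¹' {q}) with hf₃
  have hfour : ∀ a b, f₀ a * f₁ b ≤ f₂ (a ⊓ b) * f₃ (a ⊔ b) := by
    intro a b
    simp only [hf₀, hf₁, hf₂, hf₃, measureReal_def, ← ENNReal.toReal_mul]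
    exact ENNReal.toReal_mono (ENNReal.mul_ne_top (measure_ne_top _ _) (measure_ne_top _ _))
      (quad_fibre μ₀ μ₁ μ₂ μ₃ h n a b)
  have key : μ₀.real (discretize n ⁻¹' ↑S) * μ₁.real (discretize n ⁻¹' ↑T) ≤
      μ₂.real (discretize n ⁻¹' ↑(S ⊼ T)) * μ₃.real (discretize n ⁻¹' ↑(S ⊻ T)) := by
    simp only [measureReal_preimage_discretize_finset]
    exact four_functions_theorem f₀ f₁ f₂ f₃ (fun q => measureReal_nonneg) (fun q => measureReal_nonneg)
      (fun q => measureReal_nonneg) (fun q => measureReal_nonneg) hfour S T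
  calc μ₀ (discretize n ⁻¹' ↑S) * μ₁ (discretize n ⁻¹' ↑T)
      = ENNReal.ofReal (μ₀.real (discretize n ⁻¹' ↑S) * μ₁.real (discretize n ⁻¹' ↑T)) := by
        rw [ENNReal.ofReal_mul measureReal_nonneg, ofReal_measureReal, ofReal_measureReal]
    _ ≤ ENNReal.ofReal (μ₂.real (discretize n ⁻¹' ↑(S ⊼ T)) * μ₃.real (discretize n ⁻¹' ↑(S ⊻ T))) :=
        ENNReal.ofReal_le_ofReal key
    _ = μ₂ (discretize n ⁻¹' ↑(S ⊼ T)) * μ₃ (discretize n ⁻¹' ↑(S ⊻ T)) := by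
        rw [ENNReal.ofReal_mul measureReal_nonneg, ofReal_measureReal, ofReal_measureReal]

end Cells

/-! ### Compact sets, then all Borel sets -/

section Sets

variable [Fintype ι]

open scoped FinsetFamily

/-- **The four-measure inequality for compact sets** from the box form: discretise at level `n`, apply the grid
inequality, use that the meet/join cells lie in the `2·2⁻ⁿ`-thickenings of the compact sets `A ∧ B`, `A ∨ B`, and let
`n → ∞`. [this work] -/
theorem quad_isCompact (μ₀ μ₁ μ₂ μ₃ : Measure (ι → ℝ)) [IsFiniteMeasure μ₀] [IsFiniteMeasure μ₁]
    [IsFiniteMeasure μ₂] [IsFiniteMeasure μ₃]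
    (h : ∀ a b a' b' : ι → ℝ,
      μ₀ (Icc a b) * μ₁ (Icc a' b') ≤ μ₂ (Icc (a ⊓ a') (b ⊓ b')) * μ₃ (Icc (a ⊔ a') (b ⊔ b')))
    {A B : Set (ι → ℝ)} (hA : IsCompact A) (hB : IsCompact B) :
    μ₀ A * μ₁ B ≤ μ₂ (A ⊼ B) * μ₃ (A ⊻ B) := by
  classical
  set r : ℕ → ℝ := fun n => 2 * ((2:ℝ) ^ n)⁻¹ with hr
  have hr0 : Tendsto r atTop (𝓝 0) := by
    have h2 := (tendsto_inv_atTop_zero.comp (tendsto_pow_atTop_atTop_of_one_lt one_lt_two)).const_mul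
      (2:ℝ)
    simpa [hr] using h2
  have hbound : ∀ n, μ₀ A * μ₁ B ≤ μ₂ (cthickening (r n) (A ⊼ B)) * μ₃ (cthickening (r n) (A ⊻ B)) := by
    intro n
    have hfA := finite_image_discretize n hA.isBounded
    have hfB := finite_image_discretize n hB.isBounded
    calc μ₀ A * μ₁ B
        ≤ μ₀ (discretize n ⁻¹' ↑hfA.toFinset) * μ₁ (discretize n ⁻¹' ↑hfB.toFinset) := by
          rw [hfA.coe_toFinset, hfB.coe_toFinset]
          exact mul_le_mul' (measure_mono (subset_preimage_image_discretize n A))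
            (measure_mono (subset_preimage_image_discretize n B))
      _ ≤ μ₂ (discretize n ⁻¹' ↑(hfA.toFinset ⊼ hfB.toFinset)) *
            μ₃ (discretize n ⁻¹' ↑(hfA.toFinset ⊻ hfB.toFinset)) := quad_preimage_finset μ₀ μ₁ μ₂ μ₃ h n _ _
      _ ≤ μ₂ (cthickening (r n) (A ⊼ B)) * μ₃ (cthickening (r n) (A ⊻ B)) := by
          rw [Finset.coe_infs, Finset.coe_sups, hfA.coe_toFinset, hfB.coe_toFinset]
          exact mul_le_mul' (measure_mono (preimage_infs_subset_cthickening n A B))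
            (measure_mono (preimage_sups_subset_cthickening n A B))
  have hlimI : Tendsto (fun n => μ₂ (cthickening (r n) (A ⊼ B))) atTop (𝓝 (μ₂ (A ⊼ B))) :=
    (tendsto_measure_cthickening_of_isClosed ⟨1, one_pos, measure_ne_top _ _⟩
      (isCompact_infs hA hB).isClosed).comp hr0
  have hlimS : Tendsto (fun n => μ₃ (cthickening (r n) (A ⊻ B))) atTop (𝓝 (μ₃ (A ⊻ B))) :=
    (tendsto_measure_cthickening_of_isClosed ⟨1, one_pos, measure_ne_top _ _⟩
      (isCompact_sups hA hB).isClosed).comp hr0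
  exact ge_of_tendsto' (ENNReal.Tendsto.mul hlimI (Or.inr (measure_ne_top _ _)) hlimS
    (Or.inr (measure_ne_top _ _))) hbound

/-- **THE DENSITY-FREE FOUR FUNCTIONS THEOREM FOR FOUR MEASURES ON `ℝ^ι`**: the box inequality
`μ₀[a,b] μ₁[a',b'] ≤ μ₂[a ∧ a', b ∧ b'] μ₃[a ∨ a', b ∨ b']` implies `μ₀(A) μ₁(B) ≤ μ₂(A ∧ B) μ₃(A ∨ B)` for all Borel
`A, B` (images read with outer measure), for finite measures; from the compact case by inner regularity. [this work] -/
theorem quad_measurableSet (μ₀ μ₁ μ₂ μ₃ : Measure (ι → ℝ)) [IsFiniteMeasure μ₀] [IsFiniteMeasure μ₁]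
    [IsFiniteMeasure μ₂] [IsFiniteMeasure μ₃]
    (h : ∀ a b a' b' : ι → ℝ,
      μ₀ (Icc a b) * μ₁ (Icc a' b') ≤ μ₂ (Icc (a ⊓ a') (b ⊓ b')) * μ₃ (Icc (a ⊔ a') (b ⊔ b')))
    {A B : Set (ι → ℝ)} (hA : MeasurableSet A) (hB : MeasurableSet B) :
    μ₀ A * μ₁ B ≤ μ₂ (A ⊼ B) * μ₃ (A ⊻ B) := by
  set R := μ₂ (A ⊼ B) * μ₃ (A ⊻ B) with hR
  have hK : ∀ K, K ⊆ A → IsCompact K → ∀ K', K' ⊆ B → IsCompact K' → μ₀ K * μ₁ K' ≤ R :=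
    fun K hKA hK K' hK'B hK' => (quad_isCompact μ₀ μ₁ μ₂ μ₃ h hK hK').trans
      (mul_le_mul' (measure_mono (Set.infs_subset hKA hK'B)) (measure_mono (Set.sups_subset hKA hK'B)))
  rw [hA.measure_eq_iSup_isCompact_of_ne_top (measure_ne_top μ₀ A),
    hB.measure_eq_iSup_isCompact_of_ne_top (measure_ne_top μ₁ B)]
  rw [ENNReal.iSup_mul]; refine iSup_le fun K => ?_
  rw [ENNReal.iSup_mul]; refine iSup_le fun hKA => ?_
  rw [ENNReal.iSup_mul]; refine iSup_le fun hKc => ?_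
  rw [ENNReal.mul_iSup]; refine iSup_le fun K' => ?_
  rw [ENNReal.mul_iSup]; refine iSup_le fun hK'B => ?_
  rw [ENNReal.mul_iSup]; exact iSup_le fun hK'c => hK K hKA hKc K' hK'B hK'c

/-- The set inequality gives back the box inequality (closed boxes are Borel and `[a,b] ∧ [a',b'] ⊆ [a ∧ a', b ∧ b']`,
`[a,b] ∨ [a',b'] ⊆ [a ∨ a', b ∨ b']`), so the two forms are EQUIVALENT for finite measures. [this work] -/
theorem quad_box_of_measurableSet (μ₀ μ₁ μ₂ μ₃ : Measure (ι → ℝ))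
    (h : ∀ ⦃A B : Set (ι → ℝ)⦄, MeasurableSet A → MeasurableSet B → μ₀ A * μ₁ B ≤ μ₂ (A ⊼ B) * μ₃ (A ⊻ B))
    (a b a' b' : ι → ℝ) :
    μ₀ (Icc a b) * μ₁ (Icc a' b') ≤ μ₂ (Icc (a ⊓ a') (b ⊓ b')) * μ₃ (Icc (a ⊔ a') (b ⊔ b')) := by
  have h1 : Icc a b ⊼ Icc a' b' ⊆ Icc (a ⊓ a') (b ⊓ b') :=
    Set.infs_subset_iff.2 fun x hx y hy => ⟨inf_le_inf hx.1 hy.1, inf_le_inf hx.2 hy.2⟩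
  have h2 : Icc a b ⊻ Icc a' b' ⊆ Icc (a ⊔ a') (b ⊔ b') :=
    Set.sups_subset_iff.2 fun x hx y hy => ⟨sup_le_sup hx.1 hy.1, sup_le_sup hx.2 hy.2⟩
  exact (h measurableSet_Icc measurableSet_Icc).trans (mul_le_mul' (measure_mono h1) (measure_mono h2))

/-- Sanity: the diagonal case recovers box-TP₂ ⟹ set-TP₂ (Colangelo–Müller–Scarsini Thm. 1, corrected form; tree
`CMSCondC'.mIsSetTP2`) and the pair case the tp₂ order (`mBoxTP2Le.mTP2Le`). [this work] -/
theorem mTP2Le_of_quad (μ ν : Measure (ι → ℝ)) [IsFiniteMeasure μ] [IsFiniteMeasure ν] (h : mBoxTP2Le μ ν) :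
    mTP2Le μ ν := fun _ _ hA hB => quad_measurableSet μ ν μ ν h hA hB

end Sets

end Summit.CriticalPhenomena.PercolationContinuityZ3.Theorems.SahiCMTP2
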